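import Summits.NavierStokesRegularity.NavierStokesRegularity.Theorems.EulerZoomLiouvilleConservativeZoomReduction
import Summits.NavierStokesRegularity.NavierStokesRegularity.Theorems.EulerZoomLiouvilleConservativeEngineBirthmark

/-!
# ConservativeEngine (4/4) — THE DECIDING THEOREM `X_Eᶜ → Cov → (L) → NavierStokesRegularity`

NODE N30 «THE CONSERVATIVE ENGINE» (decomp-ns lens-6 g18; critic row 196, CLEARED 2026-08-30T16:11:31Z) — banking file; node header,
thesis and sources: `Theorems/EulerZoomLiouvilleConservativeEngineToolkit.lean` (1/4).  Def-free: every lens predicate is spelled by its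
body (the texts of the child route's items); proofs verbatim from `HOME/decomp-ns-lens-6/ConservativeEngine.lean` (0 sorry, std axioms).

This file: §5 — `navierStokesRegularity_of_pieces : Zᶜ → BM → X_Eᶜ → Cov → (L) → NavierStokesRegularity` (every piece spelled by its
body = the child route's item texts; Cov = `EulerZoomLiouville.TypeIOrPowerZoomable` stmt-19833 and (L) = `EulerZoomLiouville.TypeIliouvilleL`
stmt-10661 BY NAME; this IS the child route's `closes`), `classicalBirthmark : BM` and the discharged form
`navierStokesRegularity_of_conservativeEngine : X_Eᶜ → Cov → (L) → NavierStokesRegularity` (Zᶜ by `conservativeZoomReduction_proof`).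
Mechanism: no Type-I blow-up by (L); else Cov gives a power-gauged suitable pair on a cylinder at the blow-up time; shrink it inside the
life span, read the local energy EQUALITY off the classical flow (BM), zoom conservatively (Zᶜ) to a non-trivial CONSERVATIVE member of
`K_ρ`, which X_Eᶜ kills.
-/

noncomputable section

set_option linter.dupNamespace false

open MeasureTheory TopologicalSpace Set Function Filter Topology Metric Module
open scoped NNReal ENNReal InnerProductSpace RealInnerProductSpace Laplacian

namespace Summit.NavierStokesRegularity.NavierStokesRegularity.Theorems.ConservativeEngine

open Literature.Analysis Literature.Analysis.FluidPDE Literature.Analysis.FunctionSpaces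
open Summit.NavierStokesRegularity.NavierStokesRegularity.Theses.EulerZoomLiouville
open Summit.NavierStokesRegularity.NavierStokesRegularity.Theorems.SereginZoomReduction

/-! ## §5  The deciding theorem of the node

`closes : X_Eᶜ → Cov → (L) → NavierStokesRegularity` — the tree's `EulerZoomLiouville.closes` with the proved
support `Z` replaced by the proved support `Zᶜ` (§3) fed by the birthmark (§4); `X_Eᵈ` (the dissipative half of
`X_E`) is NOT a hypothesis. -/

/-- **The deciding theorem of the node, parametric form** (0 sorry; = the child route's `closes`: Zᶜ, BM,
X_Eᶜ as binders spelled by their bodies): the CONSERVATIVE engine, the route's residual `Cov` (stmt-19833, BY NAME) and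
`(L)` (stmt-10661 = `LiouvilleConjectureNS`, BY NAME) decide `NavierStokesRegularity`. -/
theorem navierStokesRegularity_of_pieces
    (hZc : ∀ ρ : ℝ, 0 < ρ → ρ ≤ 1 / 2 → ∀ (r₀ : ℝ) (z₀ : ℝ × EuclideanSpace ℝ (Fin 3)) (v : ℝ → EuclideanSpace ℝ (Fin 3) → EuclideanSpace ℝ (Fin 3)) (q : ℝ → EuclideanSpace ℝ (Fin 3) → ℝ)
    (G : ℝ → EuclideanSpace ℝ (Fin 3) → EuclideanSpace ℝ (Fin 3) →L[ℝ] EuclideanSpace ℝ (Fin 3)), 0 < r₀ → IsSuitableWeakSolutionInBall r₀ z₀ v q →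
    HasWeakSpatialGradientOn (parabolicCylinderOpens r₀ z₀) v G →
    (∀ φ : ℝ → EuclideanSpace ℝ (Fin 3) → ℝ, IsSpaceTimeTestOn (parabolicCylinderOpens r₀ z₀) φ →
      2 * 1 * ∫ t, ∫ x, frobeniusNormSq (G t x) * φ t x =
        ∫ t, ∫ x, (‖v t x‖ ^ 2 * (timeDeriv φ t x + 1 * Δ (φ t) x) +
          (‖v t x‖ ^ 2 + 2 * q t x) * ⟪v t x, gradient (φ t) x⟫)) →
    (∃ M : ℝ≥0, ∀ r ∈ Set.Ioc 0 r₀,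
      ENNReal.ofReal (r ^ (2 * ρ)) * cknA r z₀ v + ENNReal.ofReal (r ^ ρ) * cknE r z₀ G +
        ENNReal.ofReal (r ^ (2 * ρ)) * cknD r z₀ q ≤ (M : ℝ≥0∞)) →
    (∃ ε₀ : ℝ, 0 < ε₀ ∧ ∀ δ : ℝ, 0 < δ → ∃ r ∈ Set.Ioo 0 δ, ENNReal.ofReal ε₀ ≤
      ENNReal.ofReal (r ^ (2 * ρ - 2)) *
        ∫⁻ w in Set.Ioo (z₀.1 - r ^ (2 + ρ)) z₀.1 ×ˢ Metric.ball z₀.2 r, ‖v w.1 w.2‖ₑ ^ 3) →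
    ∃ (u : ℝ → EuclideanSpace ℝ (Fin 3) → EuclideanSpace ℝ (Fin 3)) (p : ℝ → EuclideanSpace ℝ (Fin 3) → ℝ) (H : ℝ → EuclideanSpace ℝ (Fin 3) → EuclideanSpace ℝ (Fin 3) →L[ℝ] EuclideanSpace ℝ (Fin 3)) (c : ℝ≥0),
      (IsSuitableWeakSolutionOn (slab (EuclideanSpace ℝ (Fin 3)) (Set.Iio 0) isOpen_Iio) 0 0 u p ∧
        HasWeakSpatialGradientOn (slab (EuclideanSpace ℝ (Fin 3)) (Set.Iio 0) isOpen_Iio) u H ∧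
        ∀ a : ℝ, 0 < a →
          ENNReal.ofReal (a ^ (2 * ρ)) * cknA a (0 : ℝ × EuclideanSpace ℝ (Fin 3)) u + ENNReal.ofReal (a ^ ρ) * cknE a (0 : ℝ × EuclideanSpace ℝ (Fin 3)) H +
            ENNReal.ofReal (a ^ (2 * ρ)) * cknD a (0 : ℝ × EuclideanSpace ℝ (Fin 3)) p ≤ (c : ℝ≥0∞)) ∧
      (∀ φ : ℝ → EuclideanSpace ℝ (Fin 3) → ℝ, IsSpaceTimeTestOn (slab (EuclideanSpace ℝ (Fin 3)) (Set.Iio 0) isOpen_Iio) φ →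
        ∫ t, ∫ x, (‖u t x‖ ^ 2 * timeDeriv φ t x + (‖u t x‖ ^ 2 + 2 * p t x) * ⟪u t x, gradient (φ t) x⟫) = 0) ∧
      ¬ (Function.uncurry u =ᵐ[volume.restrict (Set.Iio (0 : ℝ) ×ˢ (Set.univ : Set (EuclideanSpace ℝ (Fin 3))))] 0))
    (hBM : ∀ (ν T : ℝ), 0 < ν → ∀ (u : ℝ → EuclideanSpace ℝ (Fin 3) → EuclideanSpace ℝ (Fin 3)) (p : ℝ → EuclideanSpace ℝ (Fin 3) → ℝ), IsMaximalSmoothSolution ν 0 u p T →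
    ∀ (x₀ : EuclideanSpace ℝ (Fin 3)) (q : ℝ → EuclideanSpace ℝ (Fin 3) → ℝ) (G : ℝ → EuclideanSpace ℝ (Fin 3) → EuclideanSpace ℝ (Fin 3) →L[ℝ] EuclideanSpace ℝ (Fin 3)) (r : ℝ), r ^ 2 < ν * T →
    IsSuitableWeakSolutionInBall r (ν * T, x₀) (fun s y => ν⁻¹ • u (s / ν) y) q →
    HasWeakSpatialGradientOn (parabolicCylinderOpens r (ν * T, x₀)) (fun s y => ν⁻¹ • u (s / ν) y) G →
    (∀ φ : ℝ → EuclideanSpace ℝ (Fin 3) → ℝ, IsSpaceTimeTestOn (parabolicCylinderOpens r (ν * T, x₀)) φ →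
      2 * 1 * ∫ t, ∫ x, frobeniusNormSq (G t x) * φ t x =
        ∫ t, ∫ x, (‖(fun s y => ν⁻¹ • u (s / ν) y) t x‖ ^ 2 * (timeDeriv φ t x + 1 * Δ (φ t) x) +
          (‖(fun s y => ν⁻¹ • u (s / ν) y) t x‖ ^ 2 + 2 * q t x) * ⟪(fun s y => ν⁻¹ • u (s / ν) y) t x, gradient (φ t) x⟫)))
    (hXEc : ∀ ρ : ℝ, 0 < ρ → ∀ (u : ℝ → (EuclideanSpace ℝ (Fin 3)) → (EuclideanSpace ℝ (Fin 3))) (p : ℝ → (EuclideanSpace ℝ (Fin 3)) → ℝ) (H : ℝ → (EuclideanSpace ℝ (Fin 3)) → (EuclideanSpace ℝ (Fin 3)) →L[ℝ] (EuclideanSpace ℝ (Fin 3))) (c : ℝ≥0),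
      IsSuitableWeakSolutionOn (slab (EuclideanSpace ℝ (Fin 3)) (Set.Iio 0) isOpen_Iio) 0 0 u p →
      HasWeakSpatialGradientOn (slab (EuclideanSpace ℝ (Fin 3)) (Set.Iio 0) isOpen_Iio) u H →
      (∀ a : ℝ, 0 < a →
        ENNReal.ofReal (a ^ (2 * ρ)) * cknA a (0 : ℝ × (EuclideanSpace ℝ (Fin 3))) u + ENNReal.ofReal (a ^ ρ) * cknE a (0 : ℝ × (EuclideanSpace ℝ (Fin 3))) H +
          ENNReal.ofReal (a ^ (2 * ρ)) * cknD a (0 : ℝ × (EuclideanSpace ℝ (Fin 3))) p ≤ (c : ℝ≥0∞)) →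
      (∀ φ : ℝ → (EuclideanSpace ℝ (Fin 3)) → ℝ, IsSpaceTimeTestOn (slab (EuclideanSpace ℝ (Fin 3)) (Set.Iio 0) isOpen_Iio) φ →
        ∫ t, ∫ x, (‖u t x‖ ^ 2 * timeDeriv φ t x + (‖u t x‖ ^ 2 + 2 * p t x) * ⟪u t x, gradient (φ t) x⟫) = 0) →
      Function.uncurry u =ᵐ[volume.restrict (Set.Iio (0 : ℝ) ×ˢ (Set.univ : Set (EuclideanSpace ℝ (Fin 3))))] 0)
    (hCov : TypeIOrPowerZoomable) (hL : TypeIliouvilleL) : _root_.NavierStokesRegularity := by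
  apply _root_.Summit.NavierStokesRegularity.NavierStokesRegularity.Theses.TypeILiouville.Assembly_holds
  intro ν T hν hT u p hcl hLH hdec
  by_contra hext
  have hmax : IsMaximalSmoothSolution ν 0 u p T := ⟨hcl, hext⟩
  rcases hCov ν T hν hT u p hmax hLH hdec with hI | ⟨x₀, q, G, r₀, ρ, hρ, hρ', hr₀, hsw, hG, hM, hfloor⟩
  · exact _root_.Summit.NavierStokesRegularity.NavierStokesRegularity.Theorems.typeILiouville_typeIliouvilleLKillsTypeI_proof
      hL ν T hν hT u p hmax hLH hdec hI
  · -- shrink the radius so that the cylinder sits strictly inside the life span `(0, νT) × ℝ³`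
    have hνT : 0 < ν * T := mul_pos hν hT
    obtain ⟨r₁, hr₁, hr₁r₀, hr₁T⟩ : ∃ r₁ : ℝ, 0 < r₁ ∧ r₁ ≤ r₀ ∧ r₁ ^ 2 < ν * T := by
      refine ⟨min r₀ (min 1 (ν * T / 2)), lt_min hr₀ (lt_min one_pos (by positivity)), min_le_left _ _, ?_⟩
      have h0 : 0 ≤ min r₀ (min 1 (ν * T / 2)) := (lt_min hr₀ (lt_min one_pos (by positivity))).le
      have h1 : min r₀ (min 1 (ν * T / 2)) ≤ 1 := (min_le_right _ _).trans (min_le_left _ _)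
      have h2 : min r₀ (min 1 (ν * T / 2)) ≤ ν * T / 2 := (min_le_right _ _).trans (min_le_right _ _)
      nlinarith [mul_le_mul_of_nonneg_left h1 h0]
    have hle : parabolicCylinderOpens r₁ (ν * T, x₀) ≤ parabolicCylinderOpens r₀ (ν * T, x₀) := by
      intro z hz
      have hz' : z ∈ parabolicCylinder r₁ (ν * T, x₀) := hz
      show z ∈ parabolicCylinder r₀ (ν * T, x₀)
      unfold parabolicCylinder at hz' ⊢
      refine prod_mono (Ioo_subset_Ioo ?_ le_rfl) (ball_subset_ball hr₁r₀) hz'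
      have : r₁ ^ 2 ≤ r₀ ^ 2 := pow_le_pow_left₀ hr₁.le hr₁r₀ 2
      linarith
    have hsw₁ := isSuitableWeakSolutionInBall_mono_radius hsw hr₁ hr₁r₀
    have hG₁ := hG.mono hle
    have hM₁ : ∃ M : ℝ≥0, ∀ r ∈ Set.Ioc 0 r₁,
        ENNReal.ofReal (r ^ (2 * ρ)) * cknA r (ν * T, x₀) (fun s y => ν⁻¹ • u (s / ν) y) +
          ENNReal.ofReal (r ^ ρ) * cknE r (ν * T, x₀) G +
          ENNReal.ofReal (r ^ (2 * ρ)) * cknD r (ν * T, x₀) q ≤ (M : ℝ≥0∞) := by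
      obtain ⟨M, hM'⟩ := hM
      exact ⟨M, fun r hr => hM' r ⟨hr.1, hr.2.trans hr₁r₀⟩⟩
    -- the viscous birthmark of the datum, and the conservative zoom
    have hlee := hBM ν T hν u p hmax x₀ q G r₁ hr₁T hsw₁ hG₁
    obtain ⟨U, P, H, c, hclass, hcons, hne⟩ := hZc ρ hρ hρ' r₁ (ν * T, x₀)
      (fun s y => ν⁻¹ • u (s / ν) y) q G hr₁ hsw₁ hG₁ hlee hM₁ hfloor
    exact hne (hXEc ρ hρ U P H c hclass.1 hclass.2.1 hclass.2.2 hcons)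


/-- **BM — the viscous birthmark of the route datum**, as a closed statement (= the child route's support item text):
PROVED (`hasLocalEnergyEqualityOn_of_maximal`). -/
theorem classicalBirthmark :
    ∀ (ν T : ℝ), 0 < ν → ∀ (u : ℝ → EuclideanSpace ℝ (Fin 3) → EuclideanSpace ℝ (Fin 3)) (p : ℝ → EuclideanSpace ℝ (Fin 3) → ℝ), IsMaximalSmoothSolution ν 0 u p T →
    ∀ (x₀ : EuclideanSpace ℝ (Fin 3)) (q : ℝ → EuclideanSpace ℝ (Fin 3) → ℝ) (G : ℝ → EuclideanSpace ℝ (Fin 3) → EuclideanSpace ℝ (Fin 3) →L[ℝ] EuclideanSpace ℝ (Fin 3)) (r : ℝ), r ^ 2 < ν * T →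
    IsSuitableWeakSolutionInBall r (ν * T, x₀) (fun s y => ν⁻¹ • u (s / ν) y) q →
    HasWeakSpatialGradientOn (parabolicCylinderOpens r (ν * T, x₀)) (fun s y => ν⁻¹ • u (s / ν) y) G →
    (∀ φ : ℝ → EuclideanSpace ℝ (Fin 3) → ℝ, IsSpaceTimeTestOn (parabolicCylinderOpens r (ν * T, x₀)) φ →
      2 * 1 * ∫ t, ∫ x, frobeniusNormSq (G t x) * φ t x =
        ∫ t, ∫ x, (‖(fun s y => ν⁻¹ • u (s / ν) y) t x‖ ^ 2 * (timeDeriv φ t x + 1 * Δ (φ t) x) +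
          (‖(fun s y => ν⁻¹ • u (s / ν) y) t x‖ ^ 2 + 2 * q t x) * ⟪(fun s y => ν⁻¹ • u (s / ν) y) t x, gradient (φ t) x⟫)) :=
  fun _ T hν _ _ hmax _ _ _ _ hrT hsw hG => hasLocalEnergyEqualityOn_of_maximal (T := T) hν hmax hrT hsw hG

/-- **The deciding theorem of the node** `X_Eᶜ → Cov → (L) → NavierStokesRegularity` (Zᶜ and BM discharged by
`conservativeZoomReduction_proof` and `classicalBirthmark`; Cov = stmt-19833, (L) = stmt-10661 BY NAME). -/
theorem navierStokesRegularity_of_conservativeEngine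
    (hXEc : ∀ ρ : ℝ, 0 < ρ → ∀ (u : ℝ → (EuclideanSpace ℝ (Fin 3)) → (EuclideanSpace ℝ (Fin 3))) (p : ℝ → (EuclideanSpace ℝ (Fin 3)) → ℝ) (H : ℝ → (EuclideanSpace ℝ (Fin 3)) → (EuclideanSpace ℝ (Fin 3)) →L[ℝ] (EuclideanSpace ℝ (Fin 3))) (c : ℝ≥0),
      IsSuitableWeakSolutionOn (slab (EuclideanSpace ℝ (Fin 3)) (Set.Iio 0) isOpen_Iio) 0 0 u p →
      HasWeakSpatialGradientOn (slab (EuclideanSpace ℝ (Fin 3)) (Set.Iio 0) isOpen_Iio) u H →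
      (∀ a : ℝ, 0 < a →
        ENNReal.ofReal (a ^ (2 * ρ)) * cknA a (0 : ℝ × (EuclideanSpace ℝ (Fin 3))) u + ENNReal.ofReal (a ^ ρ) * cknE a (0 : ℝ × (EuclideanSpace ℝ (Fin 3))) H +
          ENNReal.ofReal (a ^ (2 * ρ)) * cknD a (0 : ℝ × (EuclideanSpace ℝ (Fin 3))) p ≤ (c : ℝ≥0∞)) →
      (∀ φ : ℝ → (EuclideanSpace ℝ (Fin 3)) → ℝ, IsSpaceTimeTestOn (slab (EuclideanSpace ℝ (Fin 3)) (Set.Iio 0) isOpen_Iio) φ →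
        ∫ t, ∫ x, (‖u t x‖ ^ 2 * timeDeriv φ t x + (‖u t x‖ ^ 2 + 2 * p t x) * ⟪u t x, gradient (φ t) x⟫) = 0) →
      Function.uncurry u =ᵐ[volume.restrict (Set.Iio (0 : ℝ) ×ˢ (Set.univ : Set (EuclideanSpace ℝ (Fin 3))))] 0)
    (hCov : TypeIOrPowerZoomable) (hL : TypeIliouvilleL) : _root_.NavierStokesRegularity :=
  navierStokesRegularity_of_pieces conservativeZoomReduction_proof classicalBirthmark hXEc hCov hL

end Summit.NavierStokesRegularity.NavierStokesRegularity.Theorems.ConservativeEngine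

end
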